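import Literature.IUT.LogVolume.TensorPacketSemilinearTransportWild
import HarnessLib

/-!
# Trace witnesses along a tower `k ⊆ k″ ⊆ k′`: item (X) of the G1-Θ memo at residue degrees divisible by `p`

abc-iut cell, prover seat abc-iut-f-167 (gen 5); sequel to `TensorPacketSemilinearTransportWild` (item (X) over
tie-free factors from an integral element `y_i` with `‖Tr_{k'_i/k_i}(y_i)‖ ≥ p^{−T_i}`, `e(k'_i) = e(k_i)·c_i·p^{T_i}`).
HERE that trace witness is produced from a TOWER `k → k″ → k'` of `ℚ_p`-algebra maps whenever the lower storey
`k″/k` has an integral element of trace one (e.g. `k″ =` the maximal tamely ramified subextension of `k'/k`, over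
which `k'` is totally wildly ramified of degree `p^T`): then `y := τ(y″)` has
`Tr_{k'/k}(y) = Tr_{k″/k}([k' : k″]·y″) = [k' : k″]`, of norm `p^{−v_p([k':k″])}`. PROVED:

* `trace_tower_eq_finrank_smul` — `Tr_{k'/k}(τ y″) = [k' : k″] • Tr_{k″/k}(y″)` (Mathlib `Algebra.trace_trace`,
  `Algebra.trace_algebraMap`);
* `exists_integral_zpow_le_norm_trace_of_tower` — the witness: `∃ y ∈ R'`, `‖Tr_{k'/k}(y)‖ ≥ p^{−v_p([k':k″])}`;
* **`packetLogμ_packetHull_orbit_slotUnion_le_of_tieFree_of_tower`** — item (X)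
  `log μ̄(hull(⋃_γ γ·⋃_i ι_i(g_i)·(R_I)^∼)) ≤ log μ̄'(hull'(⋃_{γ'} γ'·⋃_i ι'_i(σ'_i g_i)·(R'_I)^∼))`, `σ'_i = τ_i ∘ σ_i`, for
  tie-free `k_i`, towers `k_i → k″_i → k'_i` with an integral trace-one element downstairs and
  `e(k'_i) = e(k_i)·c_i·p^{v_p([k'_i : k″_i])}` (so `p ∣ f(k'_i/k_i)` is allowed: the `p`-part of the residue degree
  sits in the tame storey).

HONEST SCOPE: the integral trace-one element of the lower storey (⟺ `k″/k` tamely ramified) is a hypothesis.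
Classical local algebra over the tree's typings of (Ind1)/(Ind2)/the hull of the disputed corpus [claim: Mochizuki2012,
status: disputed]; nothing here takes a side on [IUTchIII] Cor. 3.12; typed ≠ proved. PROOF-ONLY file: no
definitions, no named `Prop` facts. [cite: Mochizuki2012, IUTchIV Prop. 1.2 (i)(ii) p. 10, Thm 1.10 proof Step (v) p. 27–28]
[cite: NeukirchANT1999, Ch. II (4.8), (5.5)] [cite: DupuyHilado2025, §4.7, §4.9, §4.12]
-/

noncomputable section

open Set Module
open scoped Pointwise TensorProduct

namespace Literature.IUT.LogVolume

/-! ## §1 The trace along a tower -/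

section Tower

variable {p : ℕ} [Fact p.Prime]
variable {K K'' K' : Type} [NontriviallyNormedField K] [NormedAlgebra ℚ_[p] K] [IsUltrametricDist K]
  [ProperSpace K] [NontriviallyNormedField K''] [NormedAlgebra ℚ_[p] K''] [IsUltrametricDist K''] [ProperSpace K'']
  [NontriviallyNormedField K'] [NormedAlgebra ℚ_[p] K'] [IsUltrametricDist K'] [ProperSpace K']

omit [IsUltrametricDist K] [ProperSpace K] [IsUltrametricDist K''] [IsUltrametricDist K'] in
/-- **`Tr_{k'/k}(τ y″) = [k' : k″] • Tr_{k″/k}(y″)`** along `ℚ_p`-algebra maps `σ : k → k″`, `τ : k″ → k'`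
(algebra structures through `σ`, `τ`, `τ ∘ σ`): `Tr_{k'/k} = Tr_{k″/k} ∘ Tr_{k'/k″}` and `Tr_{k'/k″}(τ y″) = [k':k″]·y″`.
[cite: NeukirchANT1999, Ch. II (4.8)] -/
theorem trace_tower_eq_finrank_smul (σ : K →ₐ[ℚ_[p]] K'') (τ : K'' →ₐ[ℚ_[p]] K') (y : K'') :
    (letI := (τ.comp σ).toRingHom.toAlgebra; Algebra.trace K K' (τ y)) =
      (letI := τ.toRingHom.toAlgebra; Module.finrank K'' K') •
        (letI := σ.toRingHom.toAlgebra; Algebra.trace K K'' y) := by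
  letI algK'' : Algebra K K'' := σ.toRingHom.toAlgebra
  letI algK' : Algebra K K' := (τ.comp σ).toRingHom.toAlgebra
  letI alg''' : Algebra K'' K' := τ.toRingHom.toAlgebra
  haveI : IsScalarTower K K'' K' := IsScalarTower.of_algebraMap_eq fun x => rfl
  haveI : IsScalarTower ℚ_[p] K'' K' := IsScalarTower.of_algebraMap_eq fun x => (τ.commutes x).symm
  haveI : IsScalarTower ℚ_[p] K K'' := IsScalarTower.of_algebraMap_eq fun x => (σ.commutes x).symm
  haveI : FiniteDimensional ℚ_[p] K'' := FiniteDimensional.of_locallyCompactSpace ℚ_[p]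
  haveI : FiniteDimensional ℚ_[p] K' := FiniteDimensional.of_locallyCompactSpace ℚ_[p]
  haveI : FiniteDimensional K K'' := Module.Finite.of_restrictScalars_finite ℚ_[p] K K''
  haveI : FiniteDimensional K'' K' := Module.Finite.of_restrictScalars_finite ℚ_[p] K'' K'
  have hτ : τ y = algebraMap K'' K' y := rfl
  rw [← Algebra.trace_trace (S := K''), hτ, Algebra.trace_algebraMap, map_nsmul]

omit [IsUltrametricDist K] [ProperSpace K] [IsUltrametricDist K''] in
/-- **Trace witness from a tower**: if the lower storey `k″/k` (structure through `σ`) has an integral element of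
trace one, then `k'` (structure through `τ ∘ σ`) has an integral element `y` with `‖Tr_{k'/k}(y)‖ ≥ p^{−T}`, `T` the
exponent of `p` in `[k' : k″]` (namely `y = τ y″`, `Tr_{k'/k}(y) = [k' : k″]`). [cite: NeukirchANT1999, Ch. II (4.8), (5.5)] -/
theorem exists_integral_zpow_le_norm_trace_of_tower (σ : K →ₐ[ℚ_[p]] K'') (τ : K'' →ₐ[ℚ_[p]] K')
    (hy : ∃ y : K'', ‖y‖ ≤ 1 ∧ (letI := σ.toRingHom.toAlgebra; Algebra.trace K K'' y = 1)) :
    ∃ y : K', ‖y‖ ≤ 1 ∧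
      (p : ℝ) ^ (-((letI := τ.toRingHom.toAlgebra; Module.finrank K'' K').factorization p : ℤ)) ≤
        ‖(letI := (τ.comp σ).toRingHom.toAlgebra; Algebra.trace K K' y)‖ := by
  obtain ⟨y, hy1, hytr⟩ := hy
  refine ⟨τ y, by rw [norm_map_algHom]; exact hy1, ?_⟩
  have hfin : (letI := τ.toRingHom.toAlgebra; Module.finrank K'' K') ≠ 0 := by
    letI : Algebra K'' K' := τ.toRingHom.toAlgebra
    haveI : IsScalarTower ℚ_[p] K'' K' := IsScalarTower.of_algebraMap_eq fun x => (τ.commutes x).symm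
    haveI : FiniteDimensional ℚ_[p] K' := FiniteDimensional.of_locallyCompactSpace ℚ_[p]
    haveI : FiniteDimensional K'' K' := Module.Finite.of_restrictScalars_finite ℚ_[p] K'' K'
    exact Module.finrank_pos.ne'
  rw [trace_tower_eq_finrank_smul σ τ y, hytr, nsmul_eq_mul, mul_one]
  exact zpow_neg_factorization_le_norm_natCast _ hfin

end Tower

/-! ## §2 Item (X) over tie-free factors along towers -/

variable (p : ℕ) [Fact p.Prime]
variable {I : Type} [Fintype I] [DecidableEq I] [Nonempty I]
variable (k : I → Type) [∀ i, NontriviallyNormedField (k i)] [∀ i, NormedAlgebra ℚ_[p] (k i)]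
  [∀ i, IsUltrametricDist (k i)] [∀ i, ProperSpace (k i)]
variable (k'' : I → Type) [∀ i, NontriviallyNormedField (k'' i)] [∀ i, NormedAlgebra ℚ_[p] (k'' i)]
  [∀ i, ProperSpace (k'' i)]
variable (k' : I → Type) [∀ i, NontriviallyNormedField (k' i)] [∀ i, NormedAlgebra ℚ_[p] (k' i)]
  [∀ i, IsUltrametricDist (k' i)] [∀ i, ProperSpace (k' i)]

/-- **Item (X) along towers `k_i → k″_i → k'_i` with a tame lower storey**: every `k_i` tie-free
(`e(k_i) ≠ pᵃ(p−1)`), every `k″_i` carrying an integral element of trace one over `σ_i k_i`, and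
`e(k'_i) = e(k_i)·c_i·p^{v_p([k'_i : τ_i k″_i])}` with `c_i ≥ 1` ⇒ for every packet morphism `φ` over the composites
`τ_i ∘ σ_i` and slot elements `g_i ∈ k_i^×`:
`log μ̄(hull(⋃_γ γ·⋃_i ι_i(g_i)·(R_I)^∼)) ≤ log μ̄'(hull'(⋃_{γ'} γ'·⋃_i ι'_i(τ_i(σ_i g_i))·(R'_I)^∼))`.
[cite: Mochizuki2012, IUTchIV Thm 1.10 proof Step (v) p. 27–28, Prop. 1.2 (i)(ii) p. 10] [cite: DupuyHilado2025, §4.7, §4.9, §4.12]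
[cite: NeukirchANT1999, Ch. II (4.8), (5.5)] -/
theorem packetLogμ_packetHull_orbit_slotUnion_le_of_tieFree_of_tower
    (σ : ∀ i, k i →ₐ[ℚ_[p]] k'' i) (τ : ∀ i, k'' i →ₐ[ℚ_[p]] k' i)
    (htie : ∀ (i : I) (a : ℕ), absRamificationIdx p (k i) ≠ p ^ a * (p - 1))
    (c : I → ℕ) (hc : ∀ i, c i ≠ 0)
    (he' : ∀ i, absRamificationIdx p (k' i) = absRamificationIdx p (k i) *
      (c i * p ^ (letI := (τ i).toRingHom.toAlgebra; Module.finrank (k'' i) (k' i)).factorization p))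
    (htr : ∀ i, ∃ y : k'' i, ‖y‖ ≤ 1 ∧ (letI := (σ i).toRingHom.toAlgebra; Algebra.trace (k i) (k'' i) y = 1))
    (φ : PacketAlgebra p k →ₐ[ℚ_[p]] PacketAlgebra p k')
    (hφ : ∀ (i : I) (a : k i), φ (iota p k i a) = iota p k' i ((τ i).comp (σ i) a))
    (g : Π i, k i) (hg : ∀ i, g i ≠ 0) :
    packetLogμ p k (packetHull p k
        (⋃ γ : indTwo p k, γ • ⋃ i, iota p k i (g i) • (normalizedPacket p k : Set (PacketAlgebra p k)))) ≤
      packetLogμ p k' (packetHull p k'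
        (⋃ γ : indTwo p k', γ • ⋃ i, iota p k' i ((τ i).comp (σ i) (g i)) •
          (normalizedPacket p k' : Set (PacketAlgebra p k')))) :=
  packetLogμ_packetHull_orbit_slotUnion_le_of_tieFree_of_trace p k k' (fun i => (τ i).comp (σ i)) htie
    (fun i => (letI := (τ i).toRingHom.toAlgebra; Module.finrank (k'' i) (k' i)).factorization p) c hc he'
    (fun i => exists_integral_zpow_le_norm_trace_of_tower (σ i) (τ i) (htr i)) φ hφ g hg

end Literature.IUT.LogVolume

end
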